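import Summits.ResolutionOfSingularities.ResolutionOfSingularities.Theorems.PurelyInseparableDim4ScopeWitness
import Summits.ResolutionOfSingularities.ResolutionOfSingularities.Theorems.PurelyInseparableDim4InScopeWinCert
import HarnessLib
import HarnessLib.Audit.Tags

/-!
# Purely inseparable fourfolds — the MAGIC CURVE `x_j + x_k + x_j x_k` makes `x_m · (x_j + x_k + x_j x_k) · W` BLIND
# (every field; cell res-dim4-pi, brick (δ) «unit leaves», the symbolic scope lemma asked by the desk 07:05Z)
# [OURS · counted 0 · a statement about OUR frame's Scope predicate, not about resolution]

Width seat `res-dim4-p-10` (g4).  In the unit-leaf census (CONFIGS (2,2) row) every located defence of player B in the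
PLAIN coordinate game runs through the mixed unit `1 + x_j x_k` into a translate of the curve
`u_{jk} := x_j + x_k + x_j x_k` — the «magic curve» `x_k = −x_j/(1+x_j) = −x_j + x_j² − …`, all of whose Taylor
coefficients are units, so that every point blow-up followed by the translation to its strict transform reproduces it
(TRAP-1 / T-002 of `…CoordinateTrap`, `StepKit.t002`; memo `pub/res-dim4/res-dim4-p-10/UNIT-CLASS-TEXT.md`).  This file is
the symbolic scope lemma behind the 14 + 9 + 4 + … rational-curve BLIND certificates of the in-scope certificates
`…PureLeafUnitInScope1113/1131/1311/…` (p704995, p705155, p705192): for EVERY field `K`, all pairwise distinct `j, k, m`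
and EVERY cofactor `W` with `W(e_k) ≠ 0`,

* **`MagicBlind.not_inCoordinateScope_two`** — `¬ InCoordinateScope 2 (x_m · u_{jk} · W)`: the branch
  `x_j = t`, `x_k = −t(1+t)⁻¹`, `x_m = x_l = 0` of `K⟦t⟧` kills all four partials (`x_m ↦ 0`, `u_{jk} ↦ 0`), is
  non-zero exactly on `{j, k}`, and `∂_m(x_m u W)(e_k) = u(e_k)·W(e_k) = W(e_k) ≠ 0` — res-dim4-p-3's ring-map criterion
  in res-dim4-p-7's `q = 2` branch form `IsolationCert.not_inCoordinateScope_two_of_powerSeriesCurve`;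
* **`MagicBlind.inScopeStateWins_two`** — hence every such state, every booking, is WON AT ONCE by player A in the
  IN-SCOPE game (`InScopeWinCert.inScopeStateWins_of_not_inCoordinateScope`);
* the two census shapes: `not_inCoordinateScope_T002` (`W = 1`: `x_m·u_{jk}`, T-002) and `not_inCoordinateScope_Tstar`
  (`W = 1 + x_j`: `x_m(1+x_j)u_{jk} = x_m·M_0k`, the one-state trap T* of the memo), with their in-scope wins.

Riders: a statement about the frame's `InCoordinateScope` / in-scope attractor; nothing here proves F4-C(2,2) or
resolution of singularities in dimension ≥ 4 / characteristic `p`; counted 0; AI work, weaker than expert review.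
bears_on: LADDER-RESOLUTION:D157-DOOR2 (res-dim4-pi · brick (δ) · symbolic scope lemma). Supports
stmt-ResolutionOfSingularities-16155 (helper).
-/

set_option linter.dupNamespace false

open MvPolynomial Finset

noncomputable section

namespace Summit.ResolutionOfSingularities.ResolutionOfSingularities.Theorems.PIDim4

namespace MagicBlind

open Literature.AlgebraicGeometry.Resolution

variable {K : Type} [Field K]

/-- The value at `e_k` of the magic curve is `1`. [folklore] -/
theorem eval_single_magic {j k : Fin 4} (hjk : j ≠ k) :
    MvPolynomial.eval (Pi.single k (1 : K)) (X j + X k + X j * X k : MvPolynomial (Fin 4) K) = 1 := by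
  simp [eval_X, hjk]

/-- **`x_m · (x_j + x_k + x_j x_k) · W` IS OUT OF COORDINATE SCOPE at `q = 2`** for every field, all pairwise distinct
`j, k, m` and every `W` with `W(e_k) ≠ 0`. [OURS · counted 0] [folklore] -/
theorem not_inCoordinateScope_two {j k m : Fin 4} (hjk : j ≠ k) (hjm : j ≠ m) (hkm : k ≠ m)
    (W : MvPolynomial (Fin 4) K) (hW : MvPolynomial.eval (Pi.single k (1 : K)) W ≠ 0) :
    ¬ InCoordinateScope 2 (X m * (X j + X k + X j * X k) * W) := by
  classical
  -- the magic branch: `x_j = t`, `x_k = −t(1+t)⁻¹`, the other two coordinates `0`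
  let c : Fin 4 → PowerSeries K := fun i =>
    if i = j then PowerSeries.X else if i = k then -PowerSeries.X * (1 + PowerSeries.X)⁻¹ else 0
  have h1t : PowerSeries.constantCoeff (1 + PowerSeries.X : PowerSeries K) ≠ 0 := by simp
  have hinv : (1 + PowerSeries.X : PowerSeries K) * (1 + PowerSeries.X)⁻¹ = 1 :=
    PowerSeries.mul_inv_cancel _ h1t
  -- values of the branch
  have hcj : c j = PowerSeries.X := by simp [c]
  have hck : c k = -PowerSeries.X * (1 + PowerSeries.X)⁻¹ := by simp [c, hjk.symm]
  have hcm : c m = 0 := by simp [c, hjm.symm, hkm.symm]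
  have hc0 : ∀ i, PowerSeries.constantCoeff (c i) = 0 := by
    intro i
    by_cases hij : i = j
    · subst hij; rw [hcj]; simp
    · by_cases hik : i = k
      · subst hik; rw [hck]; simp
      · simp [c, hij, hik]
  -- the branch kills the magic curve (every characteristic): t − t/(1+t) − t²/(1+t) = 0
  have hu : MvPolynomial.aeval c (X j + X k + X j * X k : MvPolynomial (Fin 4) K) = 0 := by
    simp only [map_add, map_mul, MvPolynomial.aeval_X, hcj, hck]
    linear_combination (-PowerSeries.X : PowerSeries K) * hinv
  refine IsolationCert.not_inCoordinateScope_two_of_powerSeriesCurve c hc0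
    (Finset.univ.filter fun i => i ≠ j ∧ i ≠ k) (fun i hi => ?_) (fun i => ?_) m (Pi.single k 1)
    (fun i hi => ?_) ?_
  · -- off `V = {i ∉ {j,k}}` the branch is non-zero
    have hX : (PowerSeries.X : PowerSeries K) ≠ 0 := PowerSeries.X_ne_zero
    have hor : i = j ∨ i = k := by
      by_contra hno
      push Not at hno
      exact hi (Finset.mem_filter.mpr ⟨Finset.mem_univ i, hno⟩)
    rcases hor with rfl | rfl
    · rw [hcj]; exact hX
    · rw [hck]
      refine mul_ne_zero (neg_ne_zero.mpr hX) fun h0 => ?_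
      rw [h0, mul_zero] at hinv
      exact zero_ne_one hinv
  · -- every partial derivative dies on the branch
    have hXm : MvPolynomial.aeval c (X m : MvPolynomial (Fin 4) K) = 0 := by
      rw [MvPolynomial.aeval_X, hcm]
    simp only [Derivation.leibniz, smul_eq_mul, map_add, map_mul, hu, hXm, mul_zero, zero_mul,
      add_zero]
  · -- the witness point `e_k` vanishes on `V`
    obtain ⟨-, hij, hik⟩ := Finset.mem_filter.mp hi
    simp [hik]
  · -- `∂_m (x_m u W)(e_k) = W(e_k) ≠ 0`
    have hm : (pderiv m) (X m * (X j + X k + X j * X k) * W : MvPolynomial (Fin 4) K) =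
        (X j + X k + X j * X k) * W + X m * (pderiv m) ((X j + X k + X j * X k) * W) := by
      rw [mul_assoc, Derivation.leibniz, smul_eq_mul, smul_eq_mul, pderiv_X_self, mul_one, add_comm]
    rw [hm, map_add, map_mul, map_mul, eval_single_magic hjk, one_mul, eval_X, Pi.single_apply,
      if_neg hkm.symm, zero_mul, add_zero]
    exact hW

/-- **Every such state is an in-scope A-win at once** (`q = 2`, every field, every booking). [OURS · counted 0]
[folklore] -/
theorem inScopeStateWins_two [DecidableEq K] {j k m : Fin 4} (hjk : j ≠ k) (hjm : j ≠ m) (hkm : k ≠ m)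
    (W : MvPolynomial (Fin 4) K) (hW : MvPolynomial.eval (Pi.single k (1 : K)) W ≠ 0)
    (r : Fin 4 →₀ ℕ) (exc : Finset (Fin 4)) :
    InScopeWinCert.InScopeStateWins 2 (⟨X m * (X j + X k + X j * X k) * W, r, exc⟩ : State K) :=
  InScopeWinCert.inScopeStateWins_of_not_inCoordinateScope (not_inCoordinateScope_two hjk hjm hkm W hW)

/-! ## The two census shapes -/

/-- **T-002 shape** `x_m · (x_j + x_k + x_j x_k)` is blind (every field). [OURS · counted 0] [folklore] -/
theorem not_inCoordinateScope_T002 {j k m : Fin 4} (hjk : j ≠ k) (hjm : j ≠ m) (hkm : k ≠ m) :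
    ¬ InCoordinateScope 2 (X m * (X j + X k + X j * X k) : MvPolynomial (Fin 4) K) := by
  have h := not_inCoordinateScope_two (K := K) hjk hjm hkm 1 (by simp)
  rwa [mul_one] at h

/-- **T* shape** `x_m · (1 + x_j) · (x_j + x_k + x_j x_k)` (= `x_m · M_0k` of the memo, the one-state trap reached
from the unit leaf 1113) is blind (every field). [OURS · counted 0] [folklore] -/
theorem not_inCoordinateScope_Tstar {j k m : Fin 4} (hjk : j ≠ k) (hjm : j ≠ m) (hkm : k ≠ m) :
    ¬ InCoordinateScope 2 (X m * (1 + X j) * (X j + X k + X j * X k) : MvPolynomial (Fin 4) K) := by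
  have h := not_inCoordinateScope_two (K := K) hjk hjm hkm (1 + X j)
    (by simp [eval_X, hjk])
  rwa [mul_assoc, mul_comm (X j + X k + X j * X k) (1 + X j), ← mul_assoc] at h

/-- In the in-scope game T* is won at once, every field, every booking (contrast: in the PLAIN game over `𝔽₂` it is
a one-state TRAP). [OURS · counted 0] [folklore] -/
theorem inScopeStateWins_Tstar [DecidableEq K] {j k m : Fin 4} (hjk : j ≠ k) (hjm : j ≠ m) (hkm : k ≠ m)
    (r : Fin 4 →₀ ℕ) (exc : Finset (Fin 4)) :
    InScopeWinCert.InScopeStateWins 2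
      (⟨X m * (1 + X j) * (X j + X k + X j * X k), r, exc⟩ : State K) :=
  InScopeWinCert.inScopeStateWins_of_not_inCoordinateScope (not_inCoordinateScope_Tstar hjk hjm hkm)

end MagicBlind

end Summit.ResolutionOfSingularities.ResolutionOfSingularities.Theorems.PIDim4

end
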